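import Literature.NumberTheory.GaloisRepresentations.PhiGammaModuleRobba
import HarnessLib

/-!
# `RelativeCharData.IsCompatible` is a hypothesis on the relative rank-one data, not a theorem

`PhiGammaModuleRobba.RelativeCharData 𝓣` (file `PhiGammaModuleRobba`) is a bare record whose
only field `ofCharOver A δ_A : (𝓣.ring.baseChange A).RankOneDatum` is ARBITRARY data: an abstract
stand-in for KPX's Construction 6.2.4 of the rank-one `(φ, Γ_K)`-modules `𝓡_A(π_K)(δ_A)` of
continuous characters `δ_A : Kˣ → Aˣ` [cite: KedlayaPottharstXiao2014, Construction 6.2.4].  The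
predicate `RelativeCharData.IsCompatible 𝓒` renders what the source checks FOR THAT CONSTRUCTION
("this definition is easily checked to be independent of the choice of the uniformizer … and also
tensor-functorial", loc. cit.; compatibility with base change `𝓡_A(δ) ⊗_A B ≅ 𝓡_B(δ_B)`,
[cite: BellaicheChenevier2009, §2.3.1 (arXiv:math/0602340 numbering)]): (1) over `A = E` the data
are the base change of `ofChar`, (2) transport along `σ : A → B`, (3) multiplicativity in `δ_A`.
By the design of that file ("a further datum (no theorem is a field); its compatibilities … are
the predicate `IsCompatible`") it is, like `HasDrigEtale` (see `HasDrigEtaleHypothesis.lean`) and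
its siblings, NOTHING ASSERTED: a route posits `(h𝓒 : 𝓒.IsCompatible)` about the data it uses.

This file records, sorry-free, why there is (and can be) no `IsCompatible_holds`, i.e. why the
declaration is a parametrised hypothesis and not a closed named fact — it is INDEPENDENT of the
axioms of the enriched datum:

* `RelativeCharData.exists_isCompatible` / `RelativeCharData.exists_not_isCompatible` — over
  `p = 2`, `F = ℂ`, `E = ZMod 2`, on one and the same enriched datum `𝓣` (the degenerate one:
  `(φ, Γ)`-ring `ZMod 2` with `φ = id` and `G_ℂ = 1` acting trivially, everything else trivial —
  the junk inhabitant of `HasDrigEtaleHypothesis.lean`, rebuilt in `exists_degenerate`), the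
  constant relative data `ofCharOver A δ_A := 1` SATISFY `IsCompatible`, while the relative data
  with `c = 1` and `α` a unit `≠ 1` of `A ⊗_E 𝓡` whenever there is one (still constant in `δ_A`)
  VIOLATE it: over `A = 𝔽₄ = GaloisField 2 2` (a finite nontrivial `E`-algebra with a unit
  `ω ≠ 1`) clause (3) at `δ = δ' = 1` would give `𝓡_A(1) ≅ 𝓡_A(1) ⊗ 𝓡_A(1)`, i.e. a unit `u`
  with `ω² u = ω φ(u) = ω u`, i.e. `ω = 1`.
* `RelativeCharData.not_forall_isCompatible` — hence the universal closure
  `∀ 𝓣 𝓒, 𝓒.IsCompatible` (at universe `0`, as in `PhiGammaModuleData.nonempty`) is false.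

(For some degenerate data the closure over `𝓒` alone does hold — e.g. if `φ` is the absolute
Frobenius of an `𝔽₂`-algebra then every unit is `φ(u)u⁻¹ = u` and all rank-one data with `c = 1`
are equivalent — so a witness `𝓣` has to be pinned; the argument is isolated in
`exists_not_isCompatible_of`, which only uses `φ = id` and a unit `≠ 1` in `𝔽₄ ⊗_E 𝓡`.)

What IS a theorem of the literature is that the GENUINE construction (`𝓡_A(π_K)(δ₁δ₂) =
D_rig(δ̂₁) ⊗ (D_{f,δ₂(ϖ)} ⊗ 𝓡_A(π_K))`) satisfies (1)–(3); stating that needs the Robba ring,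
`D_rig` in families and Lemma 6.2.3 of the source, which neither Mathlib nor this tree has (cf. the
named fact `PhiGammaModuleData.nonempty` of `Trianguline.lean`).

## References

* K. S. Kedlaya, J. Pottharst, L. Xiao, *Cohomology of arithmetic families of `(φ, Γ)`-modules*,
  JAMS 27 (2014), arXiv:1203.5718 — §6.2: Notation 6.2.2, Lemma 6.2.3, Construction 6.2.4
  (`lit read arxiv:1203.5718`, chunk 40). [KedlayaPottharstXiao2014]
* J. Bellaïche, G. Chenevier, *Families of Galois representations and Selmer groups*, Astérisque
  324 (2009), arXiv:math/0602340 — §2.3.1. [BellaicheChenevier2009]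

## Mathlib / Literature declarations used

From `PhiGammaModuleRobba.lean`: `PhiGammaModuleRobba`, `RelativeCharData`, `IsCompatible`,
`PhiGammaRing.baseChange` (+ `RankOneDatum`, `IsEquiv`, `mul_α`); from `Trianguline.lean`:
`PhiGammaRing`, `PhiGammaModuleData`, `FramedPhiGammaModule.trivial`, `IsIso.refl`.  Mathlib:
`IsAlgClosed.algebraMap_bijective_of_isIntegral`, `GaloisField` (+ `GaloisField.card`),
`Nat.card_units`, `Finite.one_lt_card_iff_nontrivial`, `Algebra.TensorProduct.map_id`,
`Algebra.TensorProduct.rid`, `ZMod.instSubsingletonUnits`, `continuous_of_discreteTopology`.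
-/

noncomputable section

namespace Literature.NumberTheory.GaloisRepresentations

open Field
open scoped TensorProduct

universe u v w

namespace PhiGammaModuleRobba

/-- `G_K = 1` for `K` algebraically closed: every element of `K̄` comes from `K`
(`IsAlgClosed.algebraMap_bijective_of_isIntegral`), so a `K`-automorphism is the identity.
(Re-proved, as in `HasDrigEtaleHypothesis.lean`, to spare an import.) [folklore] -/
private theorem subsingleton_absoluteGaloisGroup' (K : Type*) [Field K] [IsAlgClosed K] :
    Subsingleton (absoluteGaloisGroup K) := by
  refine ⟨fun g h => AlgEquiv.ext fun x => ?_⟩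
  obtain ⟨e, rfl⟩ :=
    (IsAlgClosed.algebraMap_bijective_of_isIntegral (k := K) (K := AlgebraicClosure K)).2 x
  rw [AlgEquiv.commutes, AlgEquiv.commutes]

namespace RelativeCharData

/-- **The mechanism.**  Let `𝓣` be ANY enriched datum over `(p, F, E) = (2, ℂ, ZMod 2)` whose
Frobenius is the identity, and `A` a finite field extension of `E = 𝔽₂` (discrete topology) such
that `A ⊗_E 𝓡` has a unit `≠ 1`.  The relative data `ofCharOver B δ_B := (α_B, c := 1)`, constant
in `δ_B`, with `α_B` a unit `≠ 1` of `B ⊗_E 𝓡` when one exists (else `1`) — legitimate rank-one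
data because `G_ℂ = 1` — violate clause (3) of `IsCompatible` over `A` at `δ = δ' = 1`: an
isomorphism `𝓡_A(1·1) ≅ 𝓡_A(1) ⊗ 𝓡_A(1)` is a unit `u` with `α² u = α φ(u) = α u`, forcing
`α = 1`. [folklore] -/
private theorem exists_not_isCompatible_of (𝓣 : PhiGammaModuleRobba.{0, 0, 0} 2 ℂ (ZMod 2))
    (hφ : ∀ x, 𝓣.ring.frob x = x) (A : Type) [Field A] [Algebra (ZMod 2) A]
    [Module.Finite (ZMod 2) A] (hw : ∃ w : (𝓣.ring.baseChange A).Rˣ, w ≠ 1) :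
    ∃ 𝓒 : 𝓣.RelativeCharData, ¬ 𝓒.IsCompatible := by
  classical
  haveI := subsingleton_absoluteGaloisGroup' ℂ
  -- the constant relative data
  let 𝓒 : 𝓣.RelativeCharData :=
    ⟨fun B _ _ _ _ _ _ _ =>
      { α := if h : ∃ w : (𝓣.ring.baseChange B).Rˣ, w ≠ 1 then h.choose else 1
        c := fun _ => 1
        c_mul := fun γ γ' => by simp
        compat := fun γ => by rw [Subsingleton.elim γ 1]; simp }⟩
  refine ⟨𝓒, fun h𝓒 => ?_⟩
  -- `A` with the discrete topology is an admissible coefficient algebra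
  letI : TopologicalSpace A := ⊥
  haveI : DiscreteTopology A := ⟨rfl⟩
  -- `φ_A = 1 ⊗ φ = id` on `A ⊗_E 𝓡`
  have hid : 𝓣.ring.frob = AlgHom.id (ZMod 2) 𝓣.ring.R := AlgHom.ext hφ
  have hφA : ∀ y : (𝓣.ring.baseChange A).R, (𝓣.ring.baseChange A).frob y = y := by
    intro y
    change Algebra.TensorProduct.map (AlgHom.id A A) 𝓣.ring.frob y = y
    rw [hid, Algebra.TensorProduct.map_id]
    rfl
  -- clause (3) over `A` at `δ = δ' = 1`
  obtain ⟨u, hu, -⟩ := h𝓒.2.2 A 1 1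
  have hα : ∀ δ : ℂˣ →ₜ* Aˣ, (𝓒.ofCharOver A δ).α = hw.choose := fun δ => dif_pos hw
  rw [PhiGammaRing.RankOneDatum.mul_α, hα, hφA, Units.val_mul] at hu
  have hwu : hw.choose * hw.choose * u = hw.choose * u :=
    Units.ext (by simpa only [Units.val_mul] using hu)
  have h2 : hw.choose * hw.choose = hw.choose * 1 := by
    rw [mul_one]
    exact mul_right_cancel hwu
  exact hw.choose_spec (mul_left_cancel h2)

/-- **The degenerate enriched datum** over `(p, F, E) = (2, ℂ, ZMod 2)`: `(φ, Γ)`-ring `ZMod 2` with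
`φ = id`, `G_ℂ = 1` acting trivially, `D_rig ρ` and `𝓡(δ)` trivial (the axioms hold as `G_ℂ = 1`
and `(ZMod 2)ˣ = 1`), discrete topology, `γ_F := 1`, `homToH1 := 0`, `IsEtale := True` (the junk
inhabitant of `HasDrigEtaleHypothesis.nonempty_of_isAlgClosed`, rebuilt here because only its
existence is exported there), together with the three properties used below: `φ = id`, a unit
`ω ⊗ 1 ≠ 1` of `𝔽₄ ⊗_E 𝓡 = 𝔽₄` (`ω ∈ 𝔽₄ˣ`, `ω ≠ 1`, exists as `#𝔽₄ˣ = 3`), and `ofChar δ = 1`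
for every `δ`. [folklore] -/
private theorem exists_degenerate :
    ∃ 𝓣 : PhiGammaModuleRobba.{0, 0, 0} 2 ℂ (ZMod 2),
      (∀ x, 𝓣.ring.frob x = x) ∧ (∃ w : (𝓣.ring.baseChange (GaloisField 2 2)).Rˣ, w ≠ 1) ∧
        ∀ δ, 𝓣.ofChar δ = 1 := by
  haveI := subsingleton_absoluteGaloisGroup' ℂ
  -- the trivial action of `G_ℂ` on `ZMod 2` by ring endomorphisms
  let act : MulSemiringAction (absoluteGaloisGroup ℂ) (ZMod 2) :=
    { smul := fun _ r => r
      one_smul := fun _ => rfl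
      mul_smul := fun _ _ _ => rfl
      smul_zero := fun _ => rfl
      smul_add := fun _ _ _ => rfl
      smul_one := fun _ => rfl
      smul_mul := fun _ _ _ => rfl }
  -- the trivial `(φ, Γ)`-ring on `ZMod 2` (`φ = id`)
  let 𝓡 : PhiGammaRing.{0, 0, 0} (absoluteGaloisGroup ℂ) (ZMod 2) :=
    { R := ZMod 2
      action := act
      smulComm := @SMulCommClass.mk _ _ _ act.toSMul _ fun _ _ _ => rfl
      frob := AlgHom.id (ZMod 2) (ZMod 2)
      frob_smul := fun _ _ => rfl }
  -- the degenerate `PhiGammaModuleData`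
  let 𝔇 : PhiGammaModuleData.{0, 0, 0} 2 ℂ (ZMod 2) :=
    { ring := 𝓡
      smul_eq_self := fun _ _ _ => rfl
      Drig := fun {n} _ => FramedPhiGammaModule.trivial 𝓡 n
      Drig_matGamma_eq_one := fun _ _ _ => rfl
      Drig_conj := fun _ _ => FramedPhiGammaModule.IsIso.refl _
      Drig_injective := fun ρ ρ' _ =>
        ⟨1, ContinuousMonoidHom.ext fun σ => by rw [Subsingleton.elim σ 1, map_one, map_one]⟩
      Drig_one := fun _ => FramedPhiGammaModule.IsIso.refl _
      charMod := fun _ => FramedPhiGammaModule.trivial 𝓡 1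
      charMod_matGamma_eq_one := fun _ _ _ => rfl
      charMod_one := FramedPhiGammaModule.IsIso.refl _
      charMod_injective := fun _ _ _ => ContinuousMonoidHom.ext fun _ => Subsingleton.elim _ _
      Drig_rank_one := fun _ => ⟨1, FramedPhiGammaModule.IsIso.refl _⟩ }
  -- the degenerate enriched datum
  let 𝓣 : PhiGammaModuleRobba.{0, 0, 0} 2 ℂ (ZMod 2) :=
    { toPhiGammaModuleData := 𝔇
      topR := inferInstanceAs (TopologicalSpace (ZMod 2))
      topRingR := inferInstanceAs (IsTopologicalRing (ZMod 2))
      continuous_frob := continuous_of_discreteTopology (α := ZMod 2)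
      continuous_act := fun _ => continuous_of_discreteTopology (α := ZMod 2)
      continuous_orbit := fun r =>
        show Continuous fun _ : absoluteGaloisGroup ℂ => r from continuous_const
      gen := 1
      dense_gen := fun x => subset_closure <| by
        rw [SetLike.mem_coe, Subsingleton.elim x 1]
        exact one_mem _
      homToH1 := 0
      IsEtale := fun _ => True }
  refine ⟨𝓣, fun _ => rfl, ?_, fun δ => PhiGammaRing.RankOneDatum.ext ?_ (funext fun γ => ?_)⟩
  · -- a unit `ω ≠ 1` of `𝔽₄` …
    have hcard : Nat.card (GaloisField 2 2)ˣ = 3 := by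
      rw [Nat.card_units, GaloisField.card 2 2 two_ne_zero]
      norm_num
    haveI : Nontrivial (GaloisField 2 2)ˣ := Finite.one_lt_card_iff_nontrivial.mp (by omega)
    obtain ⟨ω, hω⟩ := exists_ne (1 : (GaloisField 2 2)ˣ)
    -- … gives the unit `ω ⊗ 1 ≠ 1` of `𝔽₄ ⊗_E 𝓡 = 𝔽₄ ⊗_{𝔽₂} 𝔽₂`
    refine ⟨⟨(ω : GaloisField 2 2) ⊗ₜ[ZMod 2] (1 : ZMod 2),
      (↑ω⁻¹ : GaloisField 2 2) ⊗ₜ[ZMod 2] (1 : ZMod 2), ?_, ?_⟩, fun h1 => hω (Units.ext ?_)⟩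
    · show ((ω : GaloisField 2 2) ⊗ₜ[ZMod 2] (1 : ZMod 2)) *
          ((↑ω⁻¹ : GaloisField 2 2) ⊗ₜ[ZMod 2] (1 : ZMod 2)) = (1 : GaloisField 2 2 ⊗[ZMod 2] ZMod 2)
      rw [Algebra.TensorProduct.tmul_mul_tmul, Units.mul_inv, mul_one, Algebra.TensorProduct.one_def]
    · show ((↑ω⁻¹ : GaloisField 2 2) ⊗ₜ[ZMod 2] (1 : ZMod 2)) *
          ((ω : GaloisField 2 2) ⊗ₜ[ZMod 2] (1 : ZMod 2)) = (1 : GaloisField 2 2 ⊗[ZMod 2] ZMod 2)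
      rw [Algebra.TensorProduct.tmul_mul_tmul, Units.inv_mul, mul_one, Algebra.TensorProduct.one_def]
    · have h2 : ((ω : GaloisField 2 2) ⊗ₜ[ZMod 2] (1 : ZMod 2) : GaloisField 2 2 ⊗[ZMod 2] ZMod 2) = 1 :=
        congrArg Units.val h1
      simpa using congrArg (Algebra.TensorProduct.rid (ZMod 2) (ZMod 2) (GaloisField 2 2)) h2
  · -- `α` of `ofChar δ = (charMod δ).toRankOneDatum` is `det 1 = 1`
    show Matrix.GeneralLinearGroup.det (1 : GL (Fin 1) (ZMod 2)) = 1
    exact map_one _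
  · -- `c_γ` likewise
    show Matrix.GeneralLinearGroup.det (1 : GL (Fin 1) (ZMod 2)) = 1
    exact map_one _

/-- In ANY enriched datum in which every `ofChar δ` is the unit datum, the CONSTANT relative data
`ofCharOver A δ_A := 1` are compatible: all three clauses reduce to `1 ≅ 1` (base change,
transport and products of the unit datum are the unit datum). [folklore] -/
private theorem isCompatible_const_one {p : ℕ} [Fact p.Prime] {F : Type u} [Field F]
    [TopologicalSpace F] {E : Type v} [Field E] [TopologicalSpace E] [IsTopologicalRing E]
    (𝓣 : PhiGammaModuleRobba.{u, v, w} p F E) (h1 : ∀ δ, 𝓣.ofChar δ = 1) :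
    (⟨fun _ _ _ _ _ _ _ _ => 1⟩ : 𝓣.RelativeCharData).IsCompatible := by
  refine ⟨fun δ => ?_, fun _ _ _ _ _ _ _ _ _ _ _ _ _ _ _ _ _ => ⟨1, by simp, fun γ => by simp⟩,
    fun _ _ _ _ _ _ _ _ _ => ⟨1, by simp, fun γ => by simp⟩⟩
  rw [h1 δ]
  exact ⟨1, by simp, fun γ => by simp⟩

/-- **`IsCompatible` holds for some relative rank-one data** over the degenerate datum of
`exists_degenerate` (the constant data `1`): the predicate is consistent with the axioms of the
enriched datum. [folklore] -/
theorem exists_isCompatible :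
    ∃ (𝓣 : PhiGammaModuleRobba.{0, 0, 0} 2 ℂ (ZMod 2)) (𝓒 : 𝓣.RelativeCharData),
      𝓒.IsCompatible :=
  exists_degenerate.elim fun 𝓣 h => ⟨𝓣, _, isCompatible_const_one 𝓣 h.2.2⟩

/-- **`IsCompatible` fails for some relative rank-one data** over the SAME degenerate datum
(relative data constant in `δ_A`, with `α` a unit `≠ 1` of `A ⊗_E 𝓡` when there is one; clause
(3) fails over `𝔽₄`, see `exists_not_isCompatible_of`): the predicate is not a consequence of the
axioms of the enriched datum either — it is an independent hypothesis on `𝓒`. [folklore] -/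
theorem exists_not_isCompatible :
    ∃ (𝓣 : PhiGammaModuleRobba.{0, 0, 0} 2 ℂ (ZMod 2)) (𝓒 : 𝓣.RelativeCharData),
      ¬ 𝓒.IsCompatible :=
  exists_degenerate.elim fun 𝓣 h =>
    (exists_not_isCompatible_of 𝓣 h.1 (GaloisField 2 2) h.2.1).elim fun 𝓒 h𝓒 => ⟨𝓣, 𝓒, h𝓒⟩

/-- **The universal closure of `IsCompatible` is false** (witness: `exists_not_isCompatible`,
universe `0`).  Hence `RelativeCharData.IsCompatible` is a hypothesis a route assumes about the
relative rank-one data it is handed — a parametrised predicate with no `_holds` — and not a named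
fact; what the source proves is that ITS construction `𝓡_A(π_K)(δ)` has these compatibilities.
[cite: KedlayaPottharstXiao2014, Construction 6.2.4] -/
theorem not_forall_isCompatible :
    ¬ ∀ (𝓣 : PhiGammaModuleRobba.{0, 0, 0} 2 ℂ (ZMod 2)) (𝓒 : 𝓣.RelativeCharData),
        𝓒.IsCompatible := fun h =>
  exists_not_isCompatible.elim fun 𝓣 h𝓣 => h𝓣.elim fun 𝓒 h𝓒 => h𝓒 (h 𝓣 𝓒)

end RelativeCharData

end PhiGammaModuleRobba

end Literature.NumberTheory.GaloisRepresentations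

end
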